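import Literature.NumberTheory.GaloisCohomology.Howard2004.CasselsTateSkewPairingAtLevelProofs
import Literature.NumberTheory.GaloisCohomology.Howard2004.DVRSettingEngineStub
import HarnessLib

/-!
# Howard 2004, Lemma 1.6.4 ENGINE: its one typed input `HasLevelDecompositionsAt` (Thm. 1.4.2 for every
# `(T^{(j)}, 𝓕(n))`, `n ∈ 𝓝^{(j)}`) from the skew pairings `( , )_{s,1}` of Prop. 1.4.1 — proofs file

Topic `NumberTheory/GaloisCohomology/Howard2004`. THEOREMS ONLY: no definition, no named fact, no instance, no
notation, no `sorry`. Sequel of `CasselsTateSkewPairingAtLevelProofs` (x9-p1 LEAD g9: the structure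
`H¹_{𝓕(n)}(K, T^{(k)}) ≅ (R/𝔪^{e_k})^ε × (M × M)` from Howard's skew pairings) and of `DVRSettingEngineStub`
(x10b-p1-w2 g16, L164-DATA part 3: the ENGINE's typed-input slots `HasLevelDecompositions` /
`HasLevelDecompositionsAt`). Cell `pub/bsd-print-x9`; print leaf G87 = `thm161_dvrKolyvaginBound` (Howard Thm. 1.6.1),
registered pseudo-stub `stub_h161` of the μ-crux `MuInequalityCoherentPair` (stmt-BirchSwinnertonDyer-22642).

SOURCE. B. Howard, *The Heegner point Kolyvagin system*, Compositio Math. **140** (2004) = arXiv:1202.6340: §1.6 ¶1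
(p0011 L33–44: «the Selmer triple `(T^{(k)}, 𝓕, 𝓛^{(k)})` satisfies hypotheses H.0–H.5 … for `n ∈ 𝓝^{(k)}` we have a
decomposition `H¹_{𝓕(n)}(K, T^{(k)}) ≅ R^{(k),ε} ⊕ M^{(k)}(n) ⊕ M^{(k)}(n)`»), Thm. 1.4.2 and its proof (p0008
L99–L141: «Proposition 1.4.1 therefore gives a nondegenerate pairing of `R/𝔪`-vector spaces `( , )_{s,1} : V_s × W_s
→ R[𝔪]` … we must verify `(a, π^{s-1}b)_{s,1} = -(b, π^{s-1}a)_{s,1}`»).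

WHAT IS PROVED. The slot `DVRSetting.HasLevelDecompositionsAt hy` (and hence `HasLevelDecompositions`, by
`HasLevelDecompositionsAt.toHasLevelDecompositions`) is FILLED from the printed Galois input in the T*-free shape of
Howard's display: for every level `j`, every `n` with `n ⊆ 𝓛^{(j)}` and every `s = t + 1 < e_j`, a bi-additive
`R`-equivariant pairing `P : 𝓗(n)[π^{t+1}] × 𝓗(n)[π] → R/𝔪` on `𝓗(n) = H¹_{𝓕(n)}(K, T^{(j)})` whose right kernel is
exactly `π^{t+1}·𝓗(n)[π^{t+2}]` («nondegenerate on `W_s`») and with `P(a, π^t b) = -P(b, π^t a)` (the skew identity):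
* §1 `residueField_smul_cyclic` — `R/𝔪` has cyclic `π`-torsion as an `R`-module (the value-module clause);
* §2 **`hasLevelDecompositionsAt_of_skewPairings`** — from the per-`(j, n, t)` EXISTENCE of such pairings (4 clauses:
  equivariance ×2, right kernel, skew) — the total family is assembled by cases on `t + 1 < e_j` (zero pairing
  elsewhere) and fed to `exists_addEquiv_package_of_skewPairings_atLevel`; `M = Π_j R/(π^{n_j})` is finite
  (`finite_quotient_span_pi_pow`);
* §3 **`hasLevelDecompositionsAt_of_skewPairings_display`** — the same from the 5-clause shape of Howard's display
  (left kernel «nondegenerate on `V_s`» included, unused), i.e. from the letter proposed for the cell's typed input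
  C45.1′ read at `(T^{(j)}, 𝓕(n))`; and `hasLevelDecompositions_of_skewPairings_display`.

HONEST FRAMING: Prop. 1.4.1 (Flach 1990) and the skew identity are NOT proved here (hypotheses); «`ε` independent of
`n` and `k`» is not asserted (one `ε ≤ 1` per `(j, n)`, as the slot asks); `thm161_dvrKolyvaginBound` is NOT proved;
no summit statement is proved; the Birch–Swinnerton-Dyer conjecture is not proved by any of this.
-/

set_option autoImplicit false

noncomputable section

open Function NumberField IsDedekindDomain Field Module Submodule
open scoped NumberField ContRepresentation Pointwise

namespace Literature.NumberTheory.GaloisCohomology.Howard2004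

open Literature.NumberTheory.GaloisRepresentations
open Literature.NumberTheory.GaloisRepresentations.DiscreteGaloisModule

namespace DVRSetting

variable {p : ℕ} [Fact p.Prime] {K : Type} [Field K] [NumberField K]
  {R : Type} [CommRing R] [IsDomain R] [IsDiscreteValuationRing R] [Algebra ℤ_[p] R]
  {N : ℕ → Type} [∀ k, AddCommGroup (N k)] [∀ k, TopologicalSpace (N k)]
  [∀ k, DiscreteTopology (N k)] [∀ k, Module R (N k)]
  {Rk : ℕ → Type} [∀ k, CommRing (Rk k)] [∀ k, IsLocalRing (Rk k)] [∀ k, TopologicalSpace (Rk k)]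
  [∀ k, DiscreteTopology (Rk k)] [∀ k, Algebra ℤ_[p] (Rk k)] [∀ k, Algebra R (Rk k)]
  [∀ k, Module (Rk k) (N k)] [∀ k, IsScalarTower R (Rk k) (N k)]
  {Nbar : Type} [AddCommGroup Nbar] [TopologicalSpace Nbar] [DiscreteTopology Nbar]
  [∀ k, Module (Rk k) Nbar]
  {Nq : ℕ → Finset (HeightOneSpectrum (𝓞 K)) → Type} [∀ k n, AddCommGroup (Nq k n)]
  [∀ k n, TopologicalSpace (Nq k n)] [∀ k n, DiscreteTopology (Nq k n)]
  [∀ k n, Module (Rk k) (Nq k n)] [∀ k n, Module R (Nq k n)]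
  [∀ k n, IsScalarTower R (Rk k) (Nq k n)]

/-! ## §1 The value module `R/𝔪 = R[𝔪]` -/

/-- **`R/𝔪` has cyclic `π`-torsion** as an `R`-module: it is a field and `R → R/𝔪` is onto, so `b = (b a⁻¹)·a`
for `a ≠ 0` (the value-module clause of the level-package theorems for Howard's `R[𝔪]`-valued pairings).
[cite: Howard2004HeegnerKolyvagin, Thm. 1.4.2 (proof) (arXiv:1202.6340 p0008 L126–L131)] -/
theorem residueField_smul_cyclic (S : DVRSetting p K R N Rk Nbar Nq) (a b : R ⧸ IsLocalRing.maximalIdeal R)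
    (_ha : S.π • a = 0) (_hb : S.π • b = 0) (ha0 : a ≠ 0) : ∃ r : R, b = r • a := by
  letI : Field (R ⧸ IsLocalRing.maximalIdeal R) := Ideal.Quotient.field _
  obtain ⟨r, hr⟩ := Ideal.Quotient.mk_surjective (I := IsLocalRing.maximalIdeal R) (b * a⁻¹)
  refine ⟨r, ?_⟩
  rw [Algebra.smul_def, Ideal.Quotient.algebraMap_eq, hr, inv_mul_cancel_right₀ ha0]

/-! ## §2 `HasLevelDecompositionsAt` from the skew pairings (4 clauses) -/

/-- **THE ENGINE'S TYPED INPUT FROM HOWARD'S SKEW PAIRINGS.** On a `DVRSetting` with H.0–H.5 suppose that for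
every level `j`, every finite set of primes `n ⊆ 𝓛^{(j)}` (`S.levelPrimes j`) and every `t` with `t + 1 < e_j`
there is a bi-additive pairing `P : 𝓗(n)[π^{t+1}] × 𝓗(n)[π] → R/𝔪` on `𝓗(n) = H¹_{𝓕(n)}(K, T^{(j)})`
(`𝓗(n)[π^i] = Sel_{𝓕(n)} ⊓ ker π^i`), `R`-equivariant in both slots, whose RIGHT kernel is exactly
`π^{t+1}·𝓗(n)[π^{t+2}]` and which satisfies `P(a, π^t b) = -P(b, π^t a)` — Howard's «nondegenerate pairing
`( , )_{s,1} : V_s × W_s → R[𝔪]`» and «`(a, π^{s-1}b)_{s,1} = -(b, π^{s-1}a)_{s,1}`» for the triple `(T^{(j)}, 𝓕(n))`.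
Then `S.HasLevelDecompositionsAt hy`: for every such `(j, n)` an additive `R`-equivariant
`θ : 𝓗(n) ≃ (R/𝔪^{e_j})^ε × (M × M)` with `ε ≤ 1`, `M` finite.
[cite: Howard2004HeegnerKolyvagin, Thm. 1.4.2 (with proof) applied to (T^{(j)}, F(n)), §1.6 ¶1 (arXiv:1202.6340 p0008 L83–L141, p0011 L33–44)] -/
theorem hasLevelDecompositionsAt_of_skewPairings (S : DVRSetting p K R N Rk Nbar Nq) (hy : S.SatisfiesH)
    (h : ∀ (j : ℕ) (n : Finset (HeightOneSpectrum (𝓞 K))), ↑n ⊆ S.levelPrimes j → ∀ t : ℕ, t + 1 < S.e j →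
      ∃ P : ↥((((S.t j).atLevel S.jbar n).cond).selmerGroup ⊓
          (galoisCohomology.scalarMapH1 (S.T.ρ j) (S.T.hlin j) (S.π ^ (t + 1))).ker) →+
        ↥((((S.t j).atLevel S.jbar n).cond).selmerGroup ⊓
          (galoisCohomology.scalarMapH1 (S.T.ρ j) (S.T.hlin j) S.π).ker) →+ (R ⧸ IsLocalRing.maximalIdeal R),
        (∀ (r : R) (x x' : ↥((((S.t j).atLevel S.jbar n).cond).selmerGroup ⊓
              (galoisCohomology.scalarMapH1 (S.T.ρ j) (S.T.hlin j) (S.π ^ (t + 1))).ker))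
            (w : ↥((((S.t j).atLevel S.jbar n).cond).selmerGroup ⊓
              (galoisCohomology.scalarMapH1 (S.T.ρ j) (S.T.hlin j) S.π).ker)),
          (x' : galoisCohomology (S.T.ρ j) 1) =
            galoisCohomology.scalarMapH1 (S.T.ρ j) (S.T.hlin j) r (x : galoisCohomology (S.T.ρ j) 1) →
          P x' w = r • P x w) ∧
        (∀ (r : R) (x : ↥((((S.t j).atLevel S.jbar n).cond).selmerGroup ⊓
              (galoisCohomology.scalarMapH1 (S.T.ρ j) (S.T.hlin j) (S.π ^ (t + 1))).ker))
            (w w' : ↥((((S.t j).atLevel S.jbar n).cond).selmerGroup ⊓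
              (galoisCohomology.scalarMapH1 (S.T.ρ j) (S.T.hlin j) S.π).ker)),
          (w' : galoisCohomology (S.T.ρ j) 1) =
            galoisCohomology.scalarMapH1 (S.T.ρ j) (S.T.hlin j) r (w : galoisCohomology (S.T.ρ j) 1) →
          P x w' = r • P x w) ∧
        (∀ w : ↥((((S.t j).atLevel S.jbar n).cond).selmerGroup ⊓
              (galoisCohomology.scalarMapH1 (S.T.ρ j) (S.T.hlin j) S.π).ker),
          (∀ x, P x w = 0) ↔
            ∃ z ∈ (((S.t j).atLevel S.jbar n).cond).selmerGroup,
              galoisCohomology.scalarMapH1 (S.T.ρ j) (S.T.hlin j) (S.π ^ (t + 2)) z = 0 ∧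
              (w : galoisCohomology (S.T.ρ j) 1) =
                galoisCohomology.scalarMapH1 (S.T.ρ j) (S.T.hlin j) (S.π ^ (t + 1)) z) ∧
        (∀ (a b : ↥((((S.t j).atLevel S.jbar n).cond).selmerGroup ⊓
              (galoisCohomology.scalarMapH1 (S.T.ρ j) (S.T.hlin j) (S.π ^ (t + 1))).ker))
            (a' b' : ↥((((S.t j).atLevel S.jbar n).cond).selmerGroup ⊓
              (galoisCohomology.scalarMapH1 (S.T.ρ j) (S.T.hlin j) S.π).ker)),
          (a' : galoisCohomology (S.T.ρ j) 1) =
            galoisCohomology.scalarMapH1 (S.T.ρ j) (S.T.hlin j) (S.π ^ t) (a : galoisCohomology (S.T.ρ j) 1) →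
          (b' : galoisCohomology (S.T.ρ j) 1) =
            galoisCohomology.scalarMapH1 (S.T.ρ j) (S.T.hlin j) (S.π ^ t) (b : galoisCohomology (S.T.ρ j) 1) →
          P a b' = - P b a')) :
    S.HasLevelDecompositionsAt hy := by
  classical
  intro j n hn
  have hjn := h j n hn
  -- a total family of pairings: the printed one where `t + 1 < e_j`, zero elsewhere
  let P : ∀ t, ↥((((S.t j).atLevel S.jbar n).cond).selmerGroup ⊓
        (galoisCohomology.scalarMapH1 (S.T.ρ j) (S.T.hlin j) (S.π ^ (t + 1))).ker) →+
      ↥((((S.t j).atLevel S.jbar n).cond).selmerGroup ⊓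
        (galoisCohomology.scalarMapH1 (S.T.ρ j) (S.T.hlin j) S.π).ker) →+ (R ⧸ IsLocalRing.maximalIdeal R) :=
    fun t ↦ if ht : t + 1 < S.e j then (hjn t ht).choose else 0
  have hP : ∀ t (ht : t + 1 < S.e j), P t = (hjn t ht).choose := fun t ht ↦ dif_pos ht
  have hP0 : ∀ t, ¬ t + 1 < S.e j → P t = 0 := fun t ht ↦ dif_neg ht
  have hP₁ : ∀ t (r : R) (x x' : ↥((((S.t j).atLevel S.jbar n).cond).selmerGroup ⊓
        (galoisCohomology.scalarMapH1 (S.T.ρ j) (S.T.hlin j) (S.π ^ (t + 1))).ker))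
      (w : ↥((((S.t j).atLevel S.jbar n).cond).selmerGroup ⊓
        (galoisCohomology.scalarMapH1 (S.T.ρ j) (S.T.hlin j) S.π).ker)),
      (x' : galoisCohomology (S.T.ρ j) 1) =
        galoisCohomology.scalarMapH1 (S.T.ρ j) (S.T.hlin j) r (x : galoisCohomology (S.T.ρ j) 1) →
      P t x' w = r • P t x w := by
    intro t r x x' w hx'
    by_cases ht : t + 1 < S.e j
    · rw [hP t ht]; exact (hjn t ht).choose_spec.1 r x x' w hx'
    · rw [hP0 t ht]; simp
  have hP₂ : ∀ t (r : R) (x : ↥((((S.t j).atLevel S.jbar n).cond).selmerGroup ⊓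
        (galoisCohomology.scalarMapH1 (S.T.ρ j) (S.T.hlin j) (S.π ^ (t + 1))).ker))
      (w w' : ↥((((S.t j).atLevel S.jbar n).cond).selmerGroup ⊓
        (galoisCohomology.scalarMapH1 (S.T.ρ j) (S.T.hlin j) S.π).ker)),
      (w' : galoisCohomology (S.T.ρ j) 1) =
        galoisCohomology.scalarMapH1 (S.T.ρ j) (S.T.hlin j) r (w : galoisCohomology (S.T.ρ j) 1) →
      P t x w' = r • P t x w := by
    intro t r x w w' hw'
    by_cases ht : t + 1 < S.e j
    · rw [hP t ht]; exact (hjn t ht).choose_spec.2.1 r x w w' hw'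
    · rw [hP0 t ht]; simp
  have hright : ∀ t, t + 1 < S.e j → ∀ w : ↥((((S.t j).atLevel S.jbar n).cond).selmerGroup ⊓
        (galoisCohomology.scalarMapH1 (S.T.ρ j) (S.T.hlin j) S.π).ker),
      (∀ x, P t x w = 0) ↔
        ∃ z ∈ (((S.t j).atLevel S.jbar n).cond).selmerGroup,
          galoisCohomology.scalarMapH1 (S.T.ρ j) (S.T.hlin j) (S.π ^ (t + 2)) z = 0 ∧
          (w : galoisCohomology (S.T.ρ j) 1) =
            galoisCohomology.scalarMapH1 (S.T.ρ j) (S.T.hlin j) (S.π ^ (t + 1)) z := by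
    intro t ht w
    rw [hP t ht]; exact (hjn t ht).choose_spec.2.2.1 w
  have hskew : ∀ t, t + 1 < S.e j →
      ∀ (a b : ↥((((S.t j).atLevel S.jbar n).cond).selmerGroup ⊓
          (galoisCohomology.scalarMapH1 (S.T.ρ j) (S.T.hlin j) (S.π ^ (t + 1))).ker))
        (a' b' : ↥((((S.t j).atLevel S.jbar n).cond).selmerGroup ⊓
          (galoisCohomology.scalarMapH1 (S.T.ρ j) (S.T.hlin j) S.π).ker)),
      (a' : galoisCohomology (S.T.ρ j) 1) =
        galoisCohomology.scalarMapH1 (S.T.ρ j) (S.T.hlin j) (S.π ^ t) (a : galoisCohomology (S.T.ρ j) 1) →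
      (b' : galoisCohomology (S.T.ρ j) 1) =
        galoisCohomology.scalarMapH1 (S.T.ρ j) (S.T.hlin j) (S.π ^ t) (b : galoisCohomology (S.T.ρ j) 1) →
      P t a b' = - P t b a' := by
    intro t ht a b a' b' ha' hb'
    rw [hP t ht]; exact (hjn t ht).choose_spec.2.2.2 a b a' b' ha' hb'
  obtain ⟨ε, m, nj, hε, -, θ, hθ⟩ := S.exists_addEquiv_package_of_skewPairings_atLevel hy j n
    (Q := fun _ ↦ R ⧸ IsLocalRing.maximalIdeal R) (fun _ a b ha hb ha0 ↦ S.residueField_smul_cyclic a b ha hb ha0)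
    P hP₁ hP₂ hright hskew
  haveI : ∀ i : Fin m, Finite (R ⧸ Ideal.span {S.π ^ nj i}) := fun i ↦ S.finite_quotient_span_pi_pow hy (nj i)
  exact ⟨ε, hε, (Π i, R ⧸ Ideal.span {S.π ^ nj i}), inferInstance, inferInstance, inferInstance, θ, hθ⟩

/-! ## §3 The same from the 5-clause display (left kernel included) -/

/-- **THE ENGINE'S TYPED INPUT FROM THE FULL DISPLAY OF p. 1449** (5 clauses, in the order of the proposed letter
C45.1′: `R`-equivariance ×2; LEFT kernel `= π·𝓗(n)[π^{t+2}]` («nondegenerate on `V_s`», not used); RIGHT kernel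
`= π^{t+1}·𝓗(n)[π^{t+2}]` («nondegenerate on `W_s`»); skew identity) for every `(T^{(j)}, 𝓕(n))`, `n ⊆ 𝓛^{(j)}`,
`t + 1 < e_j` ⟹ `S.HasLevelDecompositionsAt hy`.
[cite: Howard2004HeegnerKolyvagin, Thm. 1.4.2 (with proof) applied to (T^{(j)}, F(n)), §1.6 ¶1 (arXiv:1202.6340 p0008 L83–L141, p0011 L33–44)] -/
theorem hasLevelDecompositionsAt_of_skewPairings_display (S : DVRSetting p K R N Rk Nbar Nq) (hy : S.SatisfiesH)
    (h : ∀ (j : ℕ) (n : Finset (HeightOneSpectrum (𝓞 K))), ↑n ⊆ S.levelPrimes j → ∀ t : ℕ, t + 1 < S.e j →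
      ∃ P : ↥((((S.t j).atLevel S.jbar n).cond).selmerGroup ⊓
          (galoisCohomology.scalarMapH1 (S.T.ρ j) (S.T.hlin j) (S.π ^ (t + 1))).ker) →+
        ↥((((S.t j).atLevel S.jbar n).cond).selmerGroup ⊓
          (galoisCohomology.scalarMapH1 (S.T.ρ j) (S.T.hlin j) S.π).ker) →+ (R ⧸ IsLocalRing.maximalIdeal R),
        (∀ (r : R) (x x' : ↥((((S.t j).atLevel S.jbar n).cond).selmerGroup ⊓
              (galoisCohomology.scalarMapH1 (S.T.ρ j) (S.T.hlin j) (S.π ^ (t + 1))).ker))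
            (w : ↥((((S.t j).atLevel S.jbar n).cond).selmerGroup ⊓
              (galoisCohomology.scalarMapH1 (S.T.ρ j) (S.T.hlin j) S.π).ker)),
          (x' : galoisCohomology (S.T.ρ j) 1) =
            galoisCohomology.scalarMapH1 (S.T.ρ j) (S.T.hlin j) r (x : galoisCohomology (S.T.ρ j) 1) →
          P x' w = r • P x w) ∧
        (∀ (r : R) (x : ↥((((S.t j).atLevel S.jbar n).cond).selmerGroup ⊓
              (galoisCohomology.scalarMapH1 (S.T.ρ j) (S.T.hlin j) (S.π ^ (t + 1))).ker))
            (w w' : ↥((((S.t j).atLevel S.jbar n).cond).selmerGroup ⊓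
              (galoisCohomology.scalarMapH1 (S.T.ρ j) (S.T.hlin j) S.π).ker)),
          (w' : galoisCohomology (S.T.ρ j) 1) =
            galoisCohomology.scalarMapH1 (S.T.ρ j) (S.T.hlin j) r (w : galoisCohomology (S.T.ρ j) 1) →
          P x w' = r • P x w) ∧
        (∀ x : ↥((((S.t j).atLevel S.jbar n).cond).selmerGroup ⊓
              (galoisCohomology.scalarMapH1 (S.T.ρ j) (S.T.hlin j) (S.π ^ (t + 1))).ker),
          (∀ w, P x w = 0) ↔
            ∃ z ∈ (((S.t j).atLevel S.jbar n).cond).selmerGroup,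
              galoisCohomology.scalarMapH1 (S.T.ρ j) (S.T.hlin j) (S.π ^ (t + 2)) z = 0 ∧
              (x : galoisCohomology (S.T.ρ j) 1) =
                galoisCohomology.scalarMapH1 (S.T.ρ j) (S.T.hlin j) S.π z) ∧
        (∀ w : ↥((((S.t j).atLevel S.jbar n).cond).selmerGroup ⊓
              (galoisCohomology.scalarMapH1 (S.T.ρ j) (S.T.hlin j) S.π).ker),
          (∀ x, P x w = 0) ↔
            ∃ z ∈ (((S.t j).atLevel S.jbar n).cond).selmerGroup,
              galoisCohomology.scalarMapH1 (S.T.ρ j) (S.T.hlin j) (S.π ^ (t + 2)) z = 0 ∧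
              (w : galoisCohomology (S.T.ρ j) 1) =
                galoisCohomology.scalarMapH1 (S.T.ρ j) (S.T.hlin j) (S.π ^ (t + 1)) z) ∧
        (∀ (a b : ↥((((S.t j).atLevel S.jbar n).cond).selmerGroup ⊓
              (galoisCohomology.scalarMapH1 (S.T.ρ j) (S.T.hlin j) (S.π ^ (t + 1))).ker))
            (a' b' : ↥((((S.t j).atLevel S.jbar n).cond).selmerGroup ⊓
              (galoisCohomology.scalarMapH1 (S.T.ρ j) (S.T.hlin j) S.π).ker)),
          (a' : galoisCohomology (S.T.ρ j) 1) =
            galoisCohomology.scalarMapH1 (S.T.ρ j) (S.T.hlin j) (S.π ^ t) (a : galoisCohomology (S.T.ρ j) 1) →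
          (b' : galoisCohomology (S.T.ρ j) 1) =
            galoisCohomology.scalarMapH1 (S.T.ρ j) (S.T.hlin j) (S.π ^ t) (b : galoisCohomology (S.T.ρ j) 1) →
          P a b' = - P b a')) :
    S.HasLevelDecompositionsAt hy :=
  S.hasLevelDecompositionsAt_of_skewPairings hy fun j n hn t ht ↦ by
    obtain ⟨P, h₁, h₂, -, h₄, h₅⟩ := h j n hn t ht
    exact ⟨P, h₁, h₂, h₄, h₅⟩

/-- The `𝓝(𝓛^{(2k-1)})`-keyed slot `HasLevelDecompositions` (which feeds `stubLength` / `stub`) from the same display.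
[cite: Howard2004HeegnerKolyvagin, Thm. 1.4.2 (with proof) applied to (T^{(j)}, F(n)), §1.6 ¶1 (arXiv:1202.6340 p0008 L83–L141, p0011 L33–44)] -/
theorem hasLevelDecompositions_of_skewPairings_display (S : DVRSetting p K R N Rk Nbar Nq) (hy : S.SatisfiesH)
    (h : ∀ (j : ℕ) (n : Finset (HeightOneSpectrum (𝓞 K))), ↑n ⊆ S.levelPrimes j → ∀ t : ℕ, t + 1 < S.e j →
      ∃ P : ↥((((S.t j).atLevel S.jbar n).cond).selmerGroup ⊓
          (galoisCohomology.scalarMapH1 (S.T.ρ j) (S.T.hlin j) (S.π ^ (t + 1))).ker) →+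
        ↥((((S.t j).atLevel S.jbar n).cond).selmerGroup ⊓
          (galoisCohomology.scalarMapH1 (S.T.ρ j) (S.T.hlin j) S.π).ker) →+ (R ⧸ IsLocalRing.maximalIdeal R),
        (∀ (r : R) (x x' : ↥((((S.t j).atLevel S.jbar n).cond).selmerGroup ⊓
              (galoisCohomology.scalarMapH1 (S.T.ρ j) (S.T.hlin j) (S.π ^ (t + 1))).ker))
            (w : ↥((((S.t j).atLevel S.jbar n).cond).selmerGroup ⊓
              (galoisCohomology.scalarMapH1 (S.T.ρ j) (S.T.hlin j) S.π).ker)),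
          (x' : galoisCohomology (S.T.ρ j) 1) =
            galoisCohomology.scalarMapH1 (S.T.ρ j) (S.T.hlin j) r (x : galoisCohomology (S.T.ρ j) 1) →
          P x' w = r • P x w) ∧
        (∀ (r : R) (x : ↥((((S.t j).atLevel S.jbar n).cond).selmerGroup ⊓
              (galoisCohomology.scalarMapH1 (S.T.ρ j) (S.T.hlin j) (S.π ^ (t + 1))).ker))
            (w w' : ↥((((S.t j).atLevel S.jbar n).cond).selmerGroup ⊓
              (galoisCohomology.scalarMapH1 (S.T.ρ j) (S.T.hlin j) S.π).ker)),
          (w' : galoisCohomology (S.T.ρ j) 1) =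
            galoisCohomology.scalarMapH1 (S.T.ρ j) (S.T.hlin j) r (w : galoisCohomology (S.T.ρ j) 1) →
          P x w' = r • P x w) ∧
        (∀ x : ↥((((S.t j).atLevel S.jbar n).cond).selmerGroup ⊓
              (galoisCohomology.scalarMapH1 (S.T.ρ j) (S.T.hlin j) (S.π ^ (t + 1))).ker),
          (∀ w, P x w = 0) ↔
            ∃ z ∈ (((S.t j).atLevel S.jbar n).cond).selmerGroup,
              galoisCohomology.scalarMapH1 (S.T.ρ j) (S.T.hlin j) (S.π ^ (t + 2)) z = 0 ∧
              (x : galoisCohomology (S.T.ρ j) 1) =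
                galoisCohomology.scalarMapH1 (S.T.ρ j) (S.T.hlin j) S.π z) ∧
        (∀ w : ↥((((S.t j).atLevel S.jbar n).cond).selmerGroup ⊓
              (galoisCohomology.scalarMapH1 (S.T.ρ j) (S.T.hlin j) S.π).ker),
          (∀ x, P x w = 0) ↔
            ∃ z ∈ (((S.t j).atLevel S.jbar n).cond).selmerGroup,
              galoisCohomology.scalarMapH1 (S.T.ρ j) (S.T.hlin j) (S.π ^ (t + 2)) z = 0 ∧
              (w : galoisCohomology (S.T.ρ j) 1) =
                galoisCohomology.scalarMapH1 (S.T.ρ j) (S.T.hlin j) (S.π ^ (t + 1)) z) ∧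
        (∀ (a b : ↥((((S.t j).atLevel S.jbar n).cond).selmerGroup ⊓
              (galoisCohomology.scalarMapH1 (S.T.ρ j) (S.T.hlin j) (S.π ^ (t + 1))).ker))
            (a' b' : ↥((((S.t j).atLevel S.jbar n).cond).selmerGroup ⊓
              (galoisCohomology.scalarMapH1 (S.T.ρ j) (S.T.hlin j) S.π).ker)),
          (a' : galoisCohomology (S.T.ρ j) 1) =
            galoisCohomology.scalarMapH1 (S.T.ρ j) (S.T.hlin j) (S.π ^ t) (a : galoisCohomology (S.T.ρ j) 1) →
          (b' : galoisCohomology (S.T.ρ j) 1) =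
            galoisCohomology.scalarMapH1 (S.T.ρ j) (S.T.hlin j) (S.π ^ t) (b : galoisCohomology (S.T.ρ j) 1) →
          P a b' = - P b a')) :
    S.HasLevelDecompositions hy :=
  (S.hasLevelDecompositionsAt_of_skewPairings_display hy h).toHasLevelDecompositions

end DVRSetting

end Literature.NumberTheory.GaloisCohomology.Howard2004
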